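import Literature.Topology.FourManifolds.ClosedBallFamilies
import Literature.Topology.FourManifolds.FrameLoop
import Literature.Topology.FourManifolds.ContMDiffNestedProd
import Mathlib.Analysis.SpecialFunctions.SmoothTransition
import HarnessLib

/-!
# Twisting the disc by a loop of diffeomorphisms of the sphere; `π₀ Diff(Dⁿ⁺¹) = 0 ⟹ π₀ Diff(Dⁿ⁺¹; Sⁿ) = 0` modulo loops

Topic `Literature/Topology/FourManifolds`. J. Cerf, *Sur les difféomorphismes de la sphère de
dimension trois (Γ₄ = 0)*, LNM 53 (1968), Ch. I §2, reduces the statement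
(2) `π₀(Diff(D³; S²)) = 0` to (4) `π₀(𝒢) = 0`, `𝒢 = Diff D³` ("on est donc ramené à montrer que le
groupe `𝒢` est connexe") through the exact sequence (3) of the locally trivial fibration
`Diff D³ → Diff S²` (restriction to the boundary, Appendice Thm. 1) with fibre `Diff(D³; S²)`:

> (3) `… → π₁(𝒢) → π₁(ℋ) → π₀(Diff(D³; S²)) → π₀(𝒢) → π₀(ℋ) → …`,

and « 2° L'application `π₁(𝒢) → π₁(ℋ)` est surjective » (Smale's theorem, Appendice Thm. 4, via
`π₁(SO(3)) → π₁(𝒢) → π₁(ℋ)`), so that the connecting map `π₁(ℋ) → π₀ Diff(D³; S²)` is zero and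
`π₀ Diff(D³; S²) → π₀(𝒢)` is injective. This file makes the connecting map and its vanishing
explicit, for every `n`, in the tree's language of smooth families:

* `exists_twistFamily` — **the twist of the disc by a two-parameter family of sphere maps**:
  for jointly `C^∞`, mutually inverse families `F_{σ,t}`, `F⁻¹_{σ,t}` of self-maps of `𝕊ⁿ` with
  `F_{σ,t} = id` for `t ≤ 0`, the maps `T_{σ,t} x = ‖x‖ • F_{σ, t λ(‖x‖)}(x/‖x‖)` (`λ` a smooth
  cutoff, `0` on `[0, 1/2]`, `1` at `1`) and their inverses are jointly `C^∞` norm-preserving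
  self-maps of `ℝⁿ⁺¹`, the identity for `t ≤ 0` and near the origin, and equal to `F_{σ,t}` on
  the unit sphere — Cerf's Lemme 2 construction `g(x, t) = (h_t(x), t)` on a collar, with two
  parameters (the lift of a loop of `ℋ` to a path of `𝒢` ending in the fibre: the connecting map);
* `exists_untwistFamily` — **the twist by a loop of isometries is diffeotopic to the identity
  rel `𝕊ⁿ`**: for a smooth loop `A_t ∈ O(n+1)` (`A_t = 1` off `(0, 1)`) the maps
  `x ↦ A_{ν(u, ‖x‖)} x`, `ν(u, r) = 1 - χ(u)(1 - λ(r))`, form a jointly smooth family from the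
  identity (`u = 0`) to the twist `x ↦ A_{λ(‖x‖)} x` (`u = 1`), fixing the unit sphere (the loop
  comes from `π₁(SO(n+1)) → π₁(𝒢)`: it lifts to a *loop* of `𝒢`);
* `relSphere_trans` — closure under composition of "diffeotopic to the identity through
  diffeomorphisms of `𝔻ⁿ⁺¹` fixing `𝕊ⁿ` pointwise";
* `relSphere_of_isDiffeotopicToId_of_loops` — **the reduction**: *assume* every smooth based
  loop in `Diff(𝕊ⁿ)` deforms, through based loops, to a loop of isometries (the families form of
  "`π₁(SO(n+1)) → π₁(Diff Sⁿ)` is onto", hypothesis `hloops`, the output shape of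
  `SphereDiffeoLoops.lean`); then every diffeomorphism `F` of `𝔻ⁿ⁺¹` fixing `𝕊ⁿ` pointwise which
  is diffeotopic to the identity in `Diff(𝔻ⁿ⁺¹)` (no boundary condition on the path) is
  diffeotopic to the identity through diffeomorphisms fixing `𝕊ⁿ` pointwise. Hence
  `discRelSphereTrivial_of_discTrivial_of_loops`: **`π₀ Diff(Dⁿ⁺¹) = 0` at the diffeomorphisms
  fixing the sphere implies `π₀ Diff(Dⁿ⁺¹; Sⁿ) = 0`**, given the loop hypothesis. For `n = 2` the
  hypothesis is Smale's theorem in families (`CerfDiscConnected.lean`).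

## The argument (Cerf, Ch. I §2, made explicit)

Let `D_t` be a diffeotopy of `𝔻` from the identity to `F` (`F|𝕊 = id`), reparametrised to be
stationary off `(0, 1)`; its boundary loop `B_t = D_t|𝕊` (`ClosedBallFamilies.lean`) is a based
smooth loop in `Diff(𝕊ⁿ)`. By `hloops` there are based loops `𝒟_{σ,·}` with `𝒟_{1,t} = B_t` and
`𝒟_{0,t} = A_t|𝕊ⁿ`, `A_t` isometries. With the twists `T_{σ,t}` of `𝒟`: `E_t = T_{1,t}|𝔻` is a
diffeotopy of `𝔻` with the same boundary loop as `D`, so `K_t = E_t⁻¹ ∘ D_t` fixes `𝕊ⁿ` pointwise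
and `F = T_{1,1} ∘ K_1`; `σ ↦ T_{0,1}⁻¹ ∘ T_{σ,1}` fixes `𝕊ⁿ` (based loops: `𝒟_{σ,1} = id`) and joins
the identity to `T_{0,1}⁻¹ ∘ T_{1,1}`; and `T_{0,1} = (x ↦ A_{λ(‖x‖)} x)` is joined to the identity
rel `𝕊ⁿ` by `exists_untwistFamily`. Composing, `F` is diffeotopic to the identity rel `𝕊ⁿ`.

Everything here is proved; there are no definitions and no named facts.

## References

* J. Cerf, *Sur les difféomorphismes de la sphère de dimension trois (Γ₄ = 0)*, Lecture Notes in
  Mathematics 53, Springer (1968), Ch. I §1 Lemme 2; Ch. I §2, (2)–(4) and the exact sequence (3);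
  Appendice §1 Thm. 1, §5 Prop. 4, Thm. 4, Cor. 2. [CerfDiffeoSphere1968]
-/

open scoped Manifold ContDiff Topology
open Set Function Metric Filter

noncomputable section

namespace Literature.Topology.FourManifolds

/-- Local notation: `𝔼 n` is the model Euclidean space `EuclideanSpace ℝ (Fin n)`. -/
local notation "𝔼 " n:arg => EuclideanSpace ℝ (Fin n)

/-- Local notation: `𝕊 n` is the unit sphere in `EuclideanSpace ℝ (Fin (n + 1))`. -/
local notation "𝕊 " n:arg => (Metric.sphere (0 : EuclideanSpace ℝ (Fin (n + 1))) 1)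

/-- Local notation: `𝔻 n` is the closed unit ball in `EuclideanSpace ℝ (Fin n)`. -/
local notation "𝔻 " n:arg => (Metric.closedBall (0 : EuclideanSpace ℝ (Fin n)) 1)

attribute [local instance] fact_finrank_euclideanSpace_succ

variable {n : ℕ}

/-! ### The radial cutoff `λ(‖x‖)` -/

/-- The radial cutoff `x ↦ χ(2‖x‖ - 1)` (`χ` the smooth transition) vanishes on the ball of
radius `1/2`. [folklore] -/
theorem radialCutoff_eq_zero {E : Type*} [NormedAddCommGroup E] {x : E} (hx : ‖x‖ ≤ 1 / 2) :
    Real.smoothTransition (2 * ‖x‖ - 1) = 0 :=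
  Real.smoothTransition.zero_of_nonpos (by linarith)

/-- The radial cutoff is `1` on the unit sphere and beyond. [folklore] -/
theorem radialCutoff_eq_one {E : Type*} [NormedAddCommGroup E] {x : E} (hx : 1 ≤ ‖x‖) :
    Real.smoothTransition (2 * ‖x‖ - 1) = 1 :=
  Real.smoothTransition.one_of_one_le (by linarith)

/-- **The radial cutoff is `C^∞` on all of `E`** (`E` a real inner product space): off the origin
it is a composition of smooth maps, and on the ball of radius `1/2` it vanishes identically.
[folklore] -/
theorem contDiff_radialCutoff {E : Type*} [NormedAddCommGroup E] [InnerProductSpace ℝ E] :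
    ContDiff ℝ ∞ fun x : E => Real.smoothTransition (2 * ‖x‖ - 1) := by
  rw [contDiff_iff_contDiffAt]
  intro x
  by_cases hx : x = 0
  · subst hx
    have hev : (fun x : E => Real.smoothTransition (2 * ‖x‖ - 1)) =ᶠ[𝓝 (0 : E)] fun _ => 0 := by
      filter_upwards [Metric.ball_mem_nhds (0 : E) (by norm_num : (0 : ℝ) < 1 / 2)] with y hy
      exact radialCutoff_eq_zero (mem_ball_zero_iff.1 hy).le
    exact contDiffAt_const.congr_of_eventuallyEq hev
  · exact Real.smoothTransition.contDiff.contDiffAt.comp x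
      ((contDiffAt_const.mul (contDiffAt_norm ℝ hx)).sub contDiffAt_const)

/-! ### The homogeneous extension of a two-parameter family of sphere maps -/

/-- **Joint smoothness of the homogeneous extension of a two-parameter family of sphere maps,
off the origin** (the form of `contDiffAt_homExt_family` for families indexed by `ℝ × ℝ` in the
nested product model). [folklore] -/
theorem contDiffAt_homExt_loopFamily (v : 𝕊 n) {F : ℝ → ℝ → (𝕊 n) → 𝕊 n}
    (hF : ContMDiff (𝓘(ℝ, ℝ).prod (𝓘(ℝ, ℝ).prod (𝓡 n))) (𝓡 n) ∞
      fun p : ℝ × (ℝ × 𝕊 n) => F p.1 p.2.1 p.2.2)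
    {a b : ℝ} {x : 𝔼 (n + 1)} (hx : x ≠ 0) :
    ContDiffAt ℝ ∞ (fun q : ℝ × (ℝ × 𝔼 (n + 1)) =>
      ‖q.2.2‖ • ((F q.1 q.2.1 (radialProjection v q.2.2) : 𝕊 n) : 𝔼 (n + 1))) (a, (b, x)) := by
  have h1 : ContMDiffAt (𝓘(ℝ, ℝ).prod (𝓘(ℝ, ℝ).prod 𝓘(ℝ, 𝔼 (n + 1))))
      (𝓘(ℝ, ℝ).prod (𝓘(ℝ, ℝ).prod (𝓡 n))) ∞
      (fun q : ℝ × (ℝ × 𝔼 (n + 1)) => ((q.1, (q.2.1, radialProjection v q.2.2)) : ℝ × (ℝ × 𝕊 n)))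
      (a, (b, x)) :=
    contMDiffAt_fst.prodMk ((contMDiffAt_fst.comp _ contMDiffAt_snd).prodMk
      ((contMDiffAt_radialProjection v hx).comp (a, (b, x)) (contMDiffAt_snd.comp _ contMDiffAt_snd)))
  have h2 : ContMDiffAt (𝓘(ℝ, ℝ).prod (𝓘(ℝ, ℝ).prod 𝓘(ℝ, 𝔼 (n + 1)))) 𝓘(ℝ, 𝔼 (n + 1)) ∞
      (fun q : ℝ × (ℝ × 𝔼 (n + 1)) =>
        ((F q.1 q.2.1 (radialProjection v q.2.2) : 𝕊 n) : 𝔼 (n + 1))) (a, (b, x)) :=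
    (contMDiff_coe_sphere.comp hF).contMDiffAt.comp (a, (b, x)) h1
  have h3 : ContDiffAt ℝ ∞ (fun q : ℝ × (ℝ × 𝔼 (n + 1)) =>
      ((F q.1 q.2.1 (radialProjection v q.2.2) : 𝕊 n) : 𝔼 (n + 1))) (a, (b, x)) :=
    contDiffAt_of_contMDiffAt_nested h2
  have h4 : ContDiffAt ℝ ∞ (fun q : ℝ × (ℝ × 𝔼 (n + 1)) => ‖q.2.2‖) (a, (b, x)) :=
    (contDiffAt_snd.comp _ contDiffAt_snd).norm ℝ hx
  exact h4.smul h3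

/-- **The twist family of the disc attached to a two-parameter family of sphere maps** (Cerf's
Lemme 2 construction `g(x, t) = (h_t x, t)` on a collar of `Sⁿ`, with parameters). Let `F_{σ,t}`,
`F⁻¹_{σ,t}` be jointly `C^∞`, mutually inverse families of self-maps of `𝕊ⁿ`, with `F_{σ,t} = id`
for `t ≤ 0`. Then `T_{σ,t} x = ‖x‖ • F_{σ, t λ(‖x‖)}(x/‖x‖)`, `λ(r) = χ(2r - 1)`, and the analogous
`T⁻¹` are jointly `C^∞` on `ℝ × ℝ × ℝⁿ⁺¹`, mutually inverse, norm-preserving, equal to `F_{σ,t}`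
on the unit sphere, and the identity for `t ≤ 0`. [cite: CerfDiffeoSphere1968, Ch. I §1, Lemme 2] -/
theorem exists_twistFamily (v : 𝕊 n) {F Finv : ℝ → ℝ → (𝕊 n) → 𝕊 n}
    (hF : ContMDiff (𝓘(ℝ, ℝ).prod (𝓘(ℝ, ℝ).prod (𝓡 n))) (𝓡 n) ∞
      fun p : ℝ × (ℝ × 𝕊 n) => F p.1 p.2.1 p.2.2)
    (hFinv : ContMDiff (𝓘(ℝ, ℝ).prod (𝓘(ℝ, ℝ).prod (𝓡 n))) (𝓡 n) ∞
      fun p : ℝ × (ℝ × 𝕊 n) => Finv p.1 p.2.1 p.2.2)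
    (h1 : ∀ σ t z, Finv σ t (F σ t z) = z) (h2 : ∀ σ t z, F σ t (Finv σ t z) = z)
    (hF0 : ∀ σ t, t ≤ 0 → ∀ z, F σ t z = z) :
    ∃ T Tinv : ℝ → ℝ → 𝔼 (n + 1) → 𝔼 (n + 1),
      ContDiff ℝ ∞ (fun q : ℝ × (ℝ × 𝔼 (n + 1)) => T q.1 q.2.1 q.2.2) ∧
      ContDiff ℝ ∞ (fun q : ℝ × (ℝ × 𝔼 (n + 1)) => Tinv q.1 q.2.1 q.2.2) ∧
      (∀ σ t x, Tinv σ t (T σ t x) = x) ∧ (∀ σ t y, T σ t (Tinv σ t y) = y) ∧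
      (∀ σ t x, ‖T σ t x‖ = ‖x‖) ∧ (∀ σ t y, ‖Tinv σ t y‖ = ‖y‖) ∧
      (∀ σ t (z : 𝕊 n), T σ t z = F σ t z) ∧ (∀ σ t (z : 𝕊 n), Tinv σ t z = Finv σ t z) ∧
      (∀ σ t, t ≤ 0 → ∀ x, T σ t x = x) ∧
      (∀ σ t x, T σ t x = ‖x‖ • ((F σ (t * Real.smoothTransition (2 * ‖x‖ - 1))
        (radialProjection v x) : 𝕊 n) : 𝔼 (n + 1))) ∧
      (∀ σ t y, Tinv σ t y = ‖y‖ • ((Finv σ (t * Real.smoothTransition (2 * ‖y‖ - 1))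
        (radialProjection v y) : 𝕊 n) : 𝔼 (n + 1))) := by
  have hFinv0 : ∀ σ t, t ≤ 0 → ∀ z, Finv σ t z = z := by
    intro σ t ht z
    conv_lhs => rw [← hF0 σ t ht z]
    exact h1 σ t z
  -- the cutoff `μ t x = t λ(‖x‖)`
  obtain ⟨μ, hμ⟩ : ∃ μ : ℝ → 𝔼 (n + 1) → ℝ,
      μ = fun t x => t * Real.smoothTransition (2 * ‖x‖ - 1) := ⟨_, rfl⟩
  have hμ0 : ∀ t (x : 𝔼 (n + 1)), ‖x‖ ≤ 1 / 2 → μ t x = 0 := fun t x hx => by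
    simp [hμ, radialCutoff_eq_zero hx]
  have hμle : ∀ t (x : 𝔼 (n + 1)), t ≤ 0 → μ t x ≤ 0 := fun t x ht => by
    rw [hμ]
    exact mul_nonpos_of_nonpos_of_nonneg ht (Real.smoothTransition.nonneg _)
  have hμ1 : ∀ t (x : 𝔼 (n + 1)), ‖x‖ = 1 → μ t x = t := fun t x hx => by
    simp [hμ, radialCutoff_eq_one hx.symm.le]
  have hμnorm : ∀ t (x y : 𝔼 (n + 1)), ‖x‖ = ‖y‖ → μ t x = μ t y := fun t x y h => by
    simp only [hμ, h]
  have hμs : ContDiff ℝ ∞ fun q : ℝ × 𝔼 (n + 1) => μ q.1 q.2 := by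
    rw [hμ]
    exact contDiff_fst.mul (contDiff_radialCutoff.comp contDiff_snd)
  refine ⟨fun σ t x => ‖x‖ • ((F σ (μ t x) (radialProjection v x) : 𝕊 n) : 𝔼 (n + 1)),
    fun σ t y => ‖y‖ • ((Finv σ (μ t y) (radialProjection v y) : 𝕊 n) : 𝔼 (n + 1)),
    ?_, ?_, ?_, ?_, fun σ t x => norm_homExt v _ x, fun σ t y => norm_homExt v _ y,
    ?_, ?_, ?_, fun σ t x => by rw [hμ], fun σ t y => by rw [hμ]⟩
  · -- smoothness of `T`
    rw [contDiff_iff_contDiffAt]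
    rintro ⟨σ, t, x⟩
    by_cases hx : x = 0
    · -- near the origin `T` is the last projection
      subst hx
      have hev : (fun q : ℝ × (ℝ × 𝔼 (n + 1)) =>
          ‖q.2.2‖ • ((F q.1 (μ q.2.1 q.2.2) (radialProjection v q.2.2) : 𝕊 n) : 𝔼 (n + 1))) =ᶠ[𝓝 (σ, (t, (0 : 𝔼 (n + 1))))]
          fun q => q.2.2 := by
        have ho : IsOpen {q : ℝ × (ℝ × 𝔼 (n + 1)) | ‖q.2.2‖ < 1 / 2} :=
          isOpen_lt (continuous_norm.comp (continuous_snd.comp continuous_snd)) continuous_const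
        filter_upwards [ho.mem_nhds (show ‖(0 : 𝔼 (n + 1))‖ < 1 / 2 by simp)] with q hq
        rw [hμ0 _ _ (le_of_lt hq), hF0 _ _ le_rfl]
        by_cases hq0 : q.2.2 = 0
        · rw [hq0, norm_zero, zero_smul]
        · exact homExt_id hq0
      exact (contDiffAt_snd.comp _ contDiffAt_snd).congr_of_eventuallyEq hev
    · have hH := contDiffAt_homExt_loopFamily v hF (a := σ) (b := μ t x) hx
      have hw : ContDiffAt ℝ ∞ (fun q : ℝ × (ℝ × 𝔼 (n + 1)) => (q.1, (μ q.2.1 q.2.2, q.2.2)))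
          (σ, (t, x)) :=
        contDiffAt_fst.prodMk (((hμs.comp contDiff_snd).contDiffAt).prodMk
          (contDiffAt_snd.comp _ contDiffAt_snd))
      have key : ContDiffAt ℝ ∞ ((fun q : ℝ × (ℝ × 𝔼 (n + 1)) =>
          ‖q.2.2‖ • ((F q.1 q.2.1 (radialProjection v q.2.2) : 𝕊 n) : 𝔼 (n + 1))) ∘
          fun q : ℝ × (ℝ × 𝔼 (n + 1)) => (q.1, (μ q.2.1 q.2.2, q.2.2))) (σ, (t, x)) :=
        hH.comp (σ, (t, x)) hw
      exact key
  · -- smoothness of `T⁻¹`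
    rw [contDiff_iff_contDiffAt]
    rintro ⟨σ, t, y⟩
    by_cases hy : y = 0
    · subst hy
      have hev : (fun q : ℝ × (ℝ × 𝔼 (n + 1)) =>
          ‖q.2.2‖ • ((Finv q.1 (μ q.2.1 q.2.2) (radialProjection v q.2.2) : 𝕊 n) : 𝔼 (n + 1))) =ᶠ[𝓝 (σ, (t, (0 : 𝔼 (n + 1))))]
          fun q => q.2.2 := by
        have ho : IsOpen {q : ℝ × (ℝ × 𝔼 (n + 1)) | ‖q.2.2‖ < 1 / 2} :=
          isOpen_lt (continuous_norm.comp (continuous_snd.comp continuous_snd)) continuous_const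
        filter_upwards [ho.mem_nhds (show ‖(0 : 𝔼 (n + 1))‖ < 1 / 2 by simp)] with q hq
        rw [hμ0 _ _ (le_of_lt hq), hFinv0 _ _ le_rfl]
        by_cases hq0 : q.2.2 = 0
        · rw [hq0, norm_zero, zero_smul]
        · exact homExt_id hq0
      exact (contDiffAt_snd.comp _ contDiffAt_snd).congr_of_eventuallyEq hev
    · have hH := contDiffAt_homExt_loopFamily v hFinv (a := σ) (b := μ t y) hy
      have hw : ContDiffAt ℝ ∞ (fun q : ℝ × (ℝ × 𝔼 (n + 1)) => (q.1, (μ q.2.1 q.2.2, q.2.2)))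
          (σ, (t, y)) :=
        contDiffAt_fst.prodMk (((hμs.comp contDiff_snd).contDiffAt).prodMk
          (contDiffAt_snd.comp _ contDiffAt_snd))
      have key : ContDiffAt ℝ ∞ ((fun q : ℝ × (ℝ × 𝔼 (n + 1)) =>
          ‖q.2.2‖ • ((Finv q.1 q.2.1 (radialProjection v q.2.2) : 𝕊 n) : 𝔼 (n + 1))) ∘
          fun q : ℝ × (ℝ × 𝔼 (n + 1)) => (q.1, (μ q.2.1 q.2.2, q.2.2))) (σ, (t, y)) :=
        hH.comp (σ, (t, y)) hw
      exact key
  · -- `T⁻¹ ∘ T = id`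
    intro σ t x
    by_cases hx : x = 0
    · subst hx; simp
    · dsimp only
      rw [hμnorm t _ x (norm_homExt v _ x), norm_homExt, radialProjection_homExt v _ hx, h1,
        homExt_id hx]
  · -- `T ∘ T⁻¹ = id`
    intro σ t y
    by_cases hy : y = 0
    · subst hy; simp
    · dsimp only
      rw [hμnorm t _ y (norm_homExt v _ y), norm_homExt, radialProjection_homExt v _ hy, h2,
        homExt_id hy]
  · -- on the unit sphere
    intro σ t z
    dsimp only
    rw [hμ1 t _ (norm_eq_of_mem_sphere z), homExt_coe_sphere]
  · intro σ t z
    dsimp only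
    rw [hμ1 t _ (norm_eq_of_mem_sphere z), homExt_coe_sphere]
  · -- identity for `t ≤ 0`
    intro σ t ht x
    dsimp only
    rw [hF0 σ _ (hμle t x ht)]
    by_cases hx : x = 0
    · subst hx; simp
    · exact homExt_id hx

/-! ### Untwisting the twist by a loop of isometries -/

/-- **Smoothness of the inverses of a smooth family of linear isometries**, as continuous linear
maps (`Ring.inverse` is `C^∞` at units of the Banach algebra `End(ℝⁿ⁺¹)`). [folklore] -/
theorem contDiff_symm_of_linearIsometryEquiv_family {A : ℝ → (𝔼 (n + 1) ≃ₗᵢ[ℝ] 𝔼 (n + 1))}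
    (hA : ContDiff ℝ ∞ fun t => (A t : 𝔼 (n + 1) →L[ℝ] 𝔼 (n + 1))) :
    ContDiff ℝ ∞ fun t => ((A t).symm : 𝔼 (n + 1) →L[ℝ] 𝔼 (n + 1)) := by
  have hAunit : ∀ t, IsUnit (A t : 𝔼 (n + 1) →L[ℝ] 𝔼 (n + 1)) := fun t =>
    ContinuousLinearMap.isUnit_iff_bijective.mpr (A t).bijective
  have hAinv : ∀ t, Ring.inverse (A t : 𝔼 (n + 1) →L[ℝ] 𝔼 (n + 1)) =
      ((A t).symm : 𝔼 (n + 1) →L[ℝ] 𝔼 (n + 1)) := by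
    intro t
    refine ContinuousLinearMap.ext fun y => ?_
    have h1 : Ring.inverse (A t : 𝔼 (n + 1) →L[ℝ] 𝔼 (n + 1)) * (A t : 𝔼 (n + 1) →L[ℝ] 𝔼 (n + 1)) =
        1 := Ring.inverse_mul_cancel _ (hAunit t)
    have h2 := congrArg (fun L : 𝔼 (n + 1) →L[ℝ] 𝔼 (n + 1) => L ((A t).symm y)) h1
    simp only [mul_apply_eq_comp, one_apply_eq_self] at h2
    have h3 : (A t : 𝔼 (n + 1) →L[ℝ] 𝔼 (n + 1)) ((A t).symm y) = y := (A t).apply_symm_apply y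
    rw [h3] at h2
    exact h2
  have h1 : ContDiff ℝ ∞ fun t => Ring.inverse (A t : 𝔼 (n + 1) →L[ℝ] 𝔼 (n + 1)) := by
    rw [contDiff_iff_contDiffAt]
    intro t
    have h3 : ContDiffAt ℝ ∞ Ring.inverse (A t : 𝔼 (n + 1) →L[ℝ] 𝔼 (n + 1)) := by
      have := contDiffAt_ringInverse ℝ (n := ∞) (hAunit t).unit
      rwa [(hAunit t).unit_spec] at this
    exact h3.comp t hA.contDiffAt
  have hfun : (fun t => ((A t).symm : 𝔼 (n + 1) →L[ℝ] 𝔼 (n + 1))) =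
      fun t => Ring.inverse (A t : 𝔼 (n + 1) →L[ℝ] 𝔼 (n + 1)) := funext fun t => (hAinv t).symm
  rw [hfun]
  exact h1

/-- **The twist by a smooth loop of isometries is joined to the identity rel `𝕊ⁿ`.** For a
smooth family `A_t` of linear isometries with `A_t = 1` for `t ≤ 0` and for `t ≥ 1`, the maps
`R_u x = A_{ν(u, ‖x‖)} x`, `ν(u, r) = 1 - χ(u)(1 - λ(r))` (`χ` the smooth transition, `λ` the
radial cutoff), and their inverses `y ↦ A_{ν(u, ‖y‖)}⁻¹ y` are jointly `C^∞`, norm-preserving,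
with `R_0 = id`, `R_1 x = A_{λ(‖x‖)} x` (the twist of the loop `A`), and `R_u = id` on the unit
sphere (`λ(1) = 1`, `A_1 = 1`). This is the lift of a loop of `SO(n+1)` to a loop — not merely a
path — of `Diff(Dⁿ⁺¹)`. [cite: CerfDiffeoSphere1968, Ch. I §2 (2° and the exact sequence (3))] -/
theorem exists_untwistFamily {A : ℝ → (𝔼 (n + 1) ≃ₗᵢ[ℝ] 𝔼 (n + 1))}
    (hA : ContDiff ℝ ∞ fun t => (A t : 𝔼 (n + 1) →L[ℝ] 𝔼 (n + 1)))
    (hA01 : ∀ t, t ≤ 0 ∨ 1 ≤ t → A t = LinearIsometryEquiv.refl ℝ (𝔼 (n + 1))) :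
    ∃ R Rinv : ℝ → 𝔼 (n + 1) → 𝔼 (n + 1),
      ContDiff ℝ ∞ (fun q : ℝ × 𝔼 (n + 1) => R q.1 q.2) ∧
      ContDiff ℝ ∞ (fun q : ℝ × 𝔼 (n + 1) => Rinv q.1 q.2) ∧
      (∀ u x, Rinv u (R u x) = x) ∧ (∀ u y, R u (Rinv u y) = y) ∧
      (∀ u x, ‖R u x‖ = ‖x‖) ∧ (∀ u y, ‖Rinv u y‖ = ‖y‖) ∧
      (∀ x, R 0 x = x) ∧
      (∀ x, R 1 x = A (Real.smoothTransition (2 * ‖x‖ - 1)) x) ∧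
      (∀ u x, ‖x‖ = 1 → R u x = x) := by
  -- `ν u x = 1 - χ(u) (1 - λ(‖x‖))`
  set ν : ℝ → 𝔼 (n + 1) → ℝ := fun u x =>
    1 - Real.smoothTransition u * (1 - Real.smoothTransition (2 * ‖x‖ - 1)) with hν
  have hνs : ContDiff ℝ ∞ fun q : ℝ × 𝔼 (n + 1) => ν q.1 q.2 :=
    contDiff_const.sub ((Real.smoothTransition.contDiff.comp contDiff_fst).mul
      (contDiff_const.sub (contDiff_radialCutoff.comp contDiff_snd)))
  have hν0 : ∀ x, ν 0 x = 1 := fun x => by simp [hν, Real.smoothTransition.zero]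
  have hν1 : ∀ x, ν 1 x = Real.smoothTransition (2 * ‖x‖ - 1) := fun x => by
    simp [hν, Real.smoothTransition.one]
  have hνsph : ∀ u (x : 𝔼 (n + 1)), ‖x‖ = 1 → ν u x = 1 := fun u x hx => by
    simp [hν, radialCutoff_eq_one hx.symm.le]
  have hνnorm : ∀ u (x y : 𝔼 (n + 1)), ‖x‖ = ‖y‖ → ν u x = ν u y := fun u x y h => by
    simp only [hν, h]
  have hA1 : A 1 = LinearIsometryEquiv.refl ℝ (𝔼 (n + 1)) := hA01 1 (Or.inr le_rfl)
  have hA' := contDiff_symm_of_linearIsometryEquiv_family hA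
  refine ⟨fun u x => A (ν u x) x, fun u y => (A (ν u y)).symm y, ?_, ?_, ?_, ?_, ?_, ?_, ?_, ?_, ?_⟩
  · exact (hA.comp hνs).clm_apply contDiff_snd
  · exact (hA'.comp hνs).clm_apply contDiff_snd
  · intro u x
    dsimp only
    rw [hνnorm u (A (ν u x) x) x (LinearIsometryEquiv.norm_map _ _), LinearIsometryEquiv.symm_apply_apply]
  · intro u y
    dsimp only
    have : ‖(A (ν u y)).symm y‖ = ‖y‖ := LinearIsometryEquiv.norm_map _ _
    rw [hνnorm u _ y this, LinearIsometryEquiv.apply_symm_apply]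
  · exact fun u x => LinearIsometryEquiv.norm_map _ _
  · exact fun u y => LinearIsometryEquiv.norm_map _ _
  · intro x
    dsimp only
    rw [hν0, hA1]
    rfl
  · intro x
    dsimp only
    rw [hν1]
  · intro u x hx
    dsimp only
    rw [hνsph u x hx, hA1]
    rfl

/-! ### Diffeotopies of the disc fixing the sphere pointwise: closure under composition -/

/-- **Closure under composition** of the relation "`φ` is the time-one stage of a diffeotopy of
`𝔻ⁿ⁺¹` all of whose stages fix `𝕊ⁿ` pointwise" (stagewise composition of the diffeotopies).
[folklore] -/
theorem relSphere_trans {φ ψ : (𝔻 (n + 1)) ≃ₘ⟮𝓡∂ (n + 1), 𝓡∂ (n + 1)⟯ (𝔻 (n + 1))}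
    (hφ : ∃ D : Diffeotopy (𝓡∂ (n + 1)) (𝔻 (n + 1)), D.stage 1 = φ ∧
      ∀ (t : ℝ) (x : 𝔻 (n + 1)), ‖(x : 𝔼 (n + 1))‖ = 1 → D.toFun t x = x)
    (hψ : ∃ D : Diffeotopy (𝓡∂ (n + 1)) (𝔻 (n + 1)), D.stage 1 = ψ ∧
      ∀ (t : ℝ) (x : 𝔻 (n + 1)), ‖(x : 𝔼 (n + 1))‖ = 1 → D.toFun t x = x) :
    ∃ D : Diffeotopy (𝓡∂ (n + 1)) (𝔻 (n + 1)), D.stage 1 = φ.trans ψ ∧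
      ∀ (t : ℝ) (x : 𝔻 (n + 1)), ‖(x : 𝔼 (n + 1))‖ = 1 → D.toFun t x = x := by
  obtain ⟨D₁, h₁, h₁'⟩ := hφ
  obtain ⟨D₂, h₂, h₂'⟩ := hψ
  refine ⟨D₁.trans D₂, ?_, fun t x hx => ?_⟩
  · ext x
    rw [Diffeotopy.coe_stage, Diffeotopy.trans_toFun, comp_apply, ← Diffeotopy.coe_stage,
      ← Diffeotopy.coe_stage, h₁, h₂, Diffeomorph.coe_trans, comp_apply]
  · rw [Diffeotopy.trans_toFun, comp_apply, h₁' t x hx, h₂' t x hx]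

/-- A diffeotopy of `𝔻ⁿ⁺¹` whose stages fix `𝕊ⁿ` pointwise and whose time-one stage agrees with
`φ` pointwise witnesses the relation for `φ`. [folklore] -/
theorem relSphere_of_toFun_eq {φ : (𝔻 (n + 1)) ≃ₘ⟮𝓡∂ (n + 1), 𝓡∂ (n + 1)⟯ (𝔻 (n + 1))}
    (D : Diffeotopy (𝓡∂ (n + 1)) (𝔻 (n + 1))) (h1 : ∀ x, D.toFun 1 x = φ x)
    (hfix : ∀ (t : ℝ) (x : 𝔻 (n + 1)), ‖(x : 𝔼 (n + 1))‖ = 1 → D.toFun t x = x) :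
    ∃ D : Diffeotopy (𝓡∂ (n + 1)) (𝔻 (n + 1)), D.stage 1 = φ ∧
      ∀ (t : ℝ) (x : 𝔻 (n + 1)), ‖(x : 𝔼 (n + 1))‖ = 1 → D.toFun t x = x :=
  ⟨D, Diffeomorph.ext fun x => by rw [Diffeotopy.coe_stage]; exact h1 x, hfix⟩

/-! ### The reduction `π₀ Diff(Dⁿ⁺¹) = 0 ⟹ π₀ Diff(Dⁿ⁺¹; Sⁿ) = 0`, modulo loops of `Diff(Sⁿ)` -/

/-- **Cerf, Ch. I §2, the step "(4) ⟹ (2)" made explicit, for every `n`, modulo the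
contraction of loops of `Diff(Sⁿ)` onto loops of isometries.** Assume (`hloops`) that every smooth
based loop `B` in `Diff(𝕊ⁿ)` (a diffeotopy with `B_t = id` for `t ≤ 0` and `t ≥ 1`) deforms
through based loops to the loop of a smooth family of isometries `A_t` (the output shape of
`exists_loopHomotopy_frameLoop_two`, `SphereDiffeoLoops.lean`). Let `F` be a diffeomorphism of
`𝔻ⁿ⁺¹` fixing `𝕊ⁿ` pointwise which is the time-one stage of SOME diffeotopy of `𝔻ⁿ⁺¹`. Then `F`
is the time-one stage of a diffeotopy of `𝔻ⁿ⁺¹` all of whose stages fix `𝕊ⁿ` pointwise: the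
connecting map `π₁(Diff Sⁿ) → π₀ Diff(Dⁿ⁺¹; Sⁿ)` of the exact sequence (3) kills the class of `F`,
and it vanishes because the boundary loop deforms to a loop of isometries, whose twist untwists
(see the module docstring). [cite: CerfDiffeoSphere1968, Ch. I §2, (3) and 2°] -/
theorem relSphere_of_isDiffeotopicToId_of_loops (v : 𝕊 n)
    (hloops : ∀ (B : Diffeotopy (𝓡 n) (𝕊 n)), (∀ t ≤ (0 : ℝ), B.toFun t = id) →
      (∀ t, (1 : ℝ) ≤ t → B.toFun t = id) →
      ∃ (A : ℝ → (𝔼 (n + 1) ≃ₗᵢ[ℝ] 𝔼 (n + 1))) (𝒟 𝒟inv : ℝ → ℝ → (𝕊 n) → 𝕊 n),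
        ContDiff ℝ ∞ (fun t => (A t : 𝔼 (n + 1) →L[ℝ] 𝔼 (n + 1))) ∧
        (∀ t, t ≤ 0 ∨ 1 ≤ t → A t = LinearIsometryEquiv.refl ℝ (𝔼 (n + 1))) ∧
        ContMDiff (𝓘(ℝ, ℝ).prod (𝓘(ℝ, ℝ).prod (𝓡 n))) (𝓡 n) ∞
          (fun p : ℝ × (ℝ × 𝕊 n) => 𝒟 p.1 p.2.1 p.2.2) ∧
        ContMDiff (𝓘(ℝ, ℝ).prod (𝓘(ℝ, ℝ).prod (𝓡 n))) (𝓡 n) ∞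
          (fun p : ℝ × (ℝ × 𝕊 n) => 𝒟inv p.1 p.2.1 p.2.2) ∧
        (∀ σ t x, 𝒟inv σ t (𝒟 σ t x) = x) ∧ (∀ σ t x, 𝒟 σ t (𝒟inv σ t x) = x) ∧
        (∀ t x, 𝒟 1 t x = B.toFun t x) ∧ (∀ t x, 𝒟 0 t x = sphereCongr (A t) x) ∧
        (∀ σ t, t ≤ 0 ∨ 1 ≤ t → ∀ x, 𝒟 σ t x = x))
    (F : (𝔻 (n + 1)) ≃ₘ⟮𝓡∂ (n + 1), 𝓡∂ (n + 1)⟯ (𝔻 (n + 1)))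
    (hF : ∀ x : 𝔻 (n + 1), ‖(x : 𝔼 (n + 1))‖ = 1 → F x = x) (hFD : Diffeomorph.IsDiffeotopicToId F) :
    ∃ D : Diffeotopy (𝓡∂ (n + 1)) (𝔻 (n + 1)), D.stage 1 = F ∧
      ∀ (t : ℝ) (x : 𝔻 (n + 1)), ‖(x : 𝔼 (n + 1))‖ = 1 → D.toFun t x = x := by
  -- Step 1: a stationary diffeotopy from `id` to `F` and its boundary loop
  obtain ⟨D₀, hD₀⟩ := hFD
  obtain ⟨D, hD_def⟩ : ∃ D : Diffeotopy (𝓡∂ (n + 1)) (𝔻 (n + 1)),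
      D = D₀.reparam Real.smoothTransition Real.smoothTransition.contDiff
        Real.smoothTransition.zero := ⟨_, rfl⟩
  have hDt : ∀ t, D.toFun t = D₀.toFun (Real.smoothTransition t) := fun t => by
    rw [hD_def, Diffeotopy.reparam_toFun]
  have hD0 : ∀ t ≤ (0 : ℝ), D.toFun t = id := fun t ht => by
    rw [hDt, Real.smoothTransition.zero_of_nonpos ht, Diffeotopy.toFun_zero]
  have hD1 : ∀ t, (1 : ℝ) ≤ t → D.toFun t = F := fun t ht => by
    rw [hDt, Real.smoothTransition.one_of_one_le ht, ← Diffeotopy.coe_stage, hD₀]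
  obtain ⟨B, hB, hBinv⟩ := D.exists_boundaryLoop
  have hB0 : ∀ t ≤ (0 : ℝ), B.toFun t = id := by
    intro t ht
    funext z
    apply Subtype.ext
    rw [hB, hD0 t ht]
    rfl
  have hB1 : ∀ t, (1 : ℝ) ≤ t → B.toFun t = id := by
    intro t ht
    funext z
    apply Subtype.ext
    rw [hB, hD1 t ht, hF ⟨z, sphere_subset_closedBall z.2⟩ (norm_eq_of_mem_sphere z)]
    rfl
  -- Step 2: deform the boundary loop to a loop of isometries, and twist the disc along
  obtain ⟨A, 𝒟, 𝒟inv, hA, hA01, h𝒟, h𝒟inv, h𝒟1, h𝒟2, h𝒟B, h𝒟A, h𝒟fix⟩ := hloops B hB0 hB1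
  have h𝒟0 : ∀ σ t, t ≤ 0 → ∀ x, 𝒟 σ t x = x := fun σ t ht => h𝒟fix σ t (Or.inl ht)
  have h𝒟invfix : ∀ σ t, t ≤ 0 ∨ 1 ≤ t → ∀ x, 𝒟inv σ t x = x := by
    intro σ t ht x
    conv_lhs => rw [← h𝒟fix σ t ht x]
    exact h𝒟1 σ t x
  obtain ⟨T, Tinv, hT, hTinv, hTT1, hTT2, hTn, hTinvn, hTsph, hTinvsph, hT0, hTform, hTinvform⟩ :=
    exists_twistFamily v h𝒟 h𝒟inv h𝒟1 h𝒟2 h𝒟0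
  -- the ball is preserved
  have hTD : ∀ σ t (x : 𝔻 (n + 1)), T σ t x ∈ 𝔻 (n + 1) := fun σ t x =>
    mem_closedBall_zero_iff.2 ((hTn σ t x).le.trans (mem_closedBall_zero_iff.1 x.2))
  have hTinvD : ∀ σ t (x : 𝔻 (n + 1)), Tinv σ t x ∈ 𝔻 (n + 1) := fun σ t x =>
    mem_closedBall_zero_iff.2 ((hTinvn σ t x).le.trans (mem_closedBall_zero_iff.1 x.2))
  -- Step 3: the diffeotopy `E_t = T_{1,t}|𝔻` with the same boundary loop as `D`
  have hkE : ContDiff ℝ ∞ (fun q : ℝ × 𝔼 (n + 1) => T 1 q.1 q.2) :=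
    hT.comp (contDiff_const.prodMk contDiff_id)
  have hkE' : ContDiff ℝ ∞ (fun q : ℝ × 𝔼 (n + 1) => Tinv 1 q.1 q.2) :=
    hTinv.comp (contDiff_const.prodMk contDiff_id)
  obtain ⟨E, hE, hEinv⟩ := Diffeotopy.exists_ofAmbient (n := n)
    (k := fun q : ℝ × 𝔼 (n + 1) => T 1 q.1 q.2) (k' := fun q : ℝ × 𝔼 (n + 1) => Tinv 1 q.1 q.2)
    hkE hkE'
    (fun t x => hTD 1 t x) (fun t x => hTinvD 1 t x) (fun t x => hTT1 1 t x) (fun t x => hTT2 1 t x)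
    (fun x => hT0 1 0 le_rfl x)
  have hE' : ∀ (t : ℝ) (x : 𝔻 (n + 1)), ((E.toFun t x : 𝔻 (n + 1)) : 𝔼 (n + 1)) = T 1 t x :=
    fun t x => hE t x
  -- `K_t = E_t⁻¹ ∘ D_t` fixes the sphere pointwise and ends at `T_{1,1}⁻¹ ∘ F`
  obtain ⟨K, hK_def⟩ : ∃ K : Diffeotopy (𝓡∂ (n + 1)) (𝔻 (n + 1)), K = D.trans E.inv := ⟨_, rfl⟩
  have hK : ∀ t x, K.toFun t x = E.invFun t (D.toFun t x) := fun t x => by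
    rw [hK_def, Diffeotopy.trans_toFun, comp_apply, Diffeotopy.inv_toFun]
  have hKfix : ∀ (t : ℝ) (x : 𝔻 (n + 1)), ‖(x : 𝔼 (n + 1))‖ = 1 → K.toFun t x = x := by
    intro t x hx
    rw [hK]
    -- `E_t x = D_t x` on the sphere, so `E_t⁻¹ (D_t x) = x`
    have hz : (x : 𝔼 (n + 1)) ∈ 𝕊 n := mem_sphere_zero_iff_norm.2 hx
    have hEx : E.toFun t x = D.toFun t x := by
      apply Subtype.ext
      rw [hE', show T 1 t (x : 𝔼 (n + 1)) = ((𝒟 1 t ⟨x, hz⟩ : 𝕊 n) : 𝔼 (n + 1)) from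
        hTsph 1 t ⟨x, hz⟩, h𝒟B, hB]
    rw [← hEx, E.invFun_toFun]
  -- Step 4: `σ ↦ T_{0,1}⁻¹ ∘ T_{σ,1}` fixes the sphere and joins `id` to `T_{0,1}⁻¹ ∘ T_{1,1}`
  have hkS : ContDiff ℝ ∞ (fun q : ℝ × 𝔼 (n + 1) => Tinv 0 1 (T q.1 1 q.2)) := by
    have hg : ContDiff ℝ ∞ (fun y : 𝔼 (n + 1) => Tinv 0 1 y) :=
      hTinv.comp (contDiff_const.prodMk (contDiff_const.prodMk contDiff_id))
    have hf : ContDiff ℝ ∞ (fun q : ℝ × 𝔼 (n + 1) => T q.1 1 q.2) :=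
      hT.comp (contDiff_fst.prodMk (contDiff_const.prodMk contDiff_snd))
    exact hg.comp hf
  have hkS' : ContDiff ℝ ∞ (fun q : ℝ × 𝔼 (n + 1) => Tinv q.1 1 (T 0 1 q.2)) := by
    have hg : ContDiff ℝ ∞ (fun q : ℝ × 𝔼 (n + 1) => Tinv q.1 1 q.2) :=
      hTinv.comp (contDiff_fst.prodMk (contDiff_const.prodMk contDiff_snd))
    have hf : ContDiff ℝ ∞ (fun q : ℝ × 𝔼 (n + 1) => (q.1, T 0 1 q.2)) :=
      contDiff_fst.prodMk (hT.comp (contDiff_const.prodMk (contDiff_const.prodMk contDiff_snd)))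
    exact hg.comp hf
  obtain ⟨ES, hES, hESinv⟩ := Diffeotopy.exists_ofAmbient (n := n)
    (k := fun q : ℝ × 𝔼 (n + 1) => Tinv 0 1 (T q.1 1 q.2))
    (k' := fun q : ℝ × 𝔼 (n + 1) => Tinv q.1 1 (T 0 1 q.2)) hkS hkS'
    (fun u x => hTinvD 0 1 ⟨_, hTD u 1 x⟩) (fun u x => hTinvD u 1 ⟨_, hTD 0 1 x⟩)
    (fun u x => by simp only [hTT2, hTT1]) (fun u x => by simp only [hTT2, hTT1])
    (fun x => hTT1 0 1 x)
  have hES' : ∀ (u : ℝ) (x : 𝔻 (n + 1)),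
      ((ES.toFun u x : 𝔻 (n + 1)) : 𝔼 (n + 1)) = Tinv 0 1 (T u 1 x) := fun u x => hES u x
  have hESfix : ∀ (u : ℝ) (x : 𝔻 (n + 1)), ‖(x : 𝔼 (n + 1))‖ = 1 → ES.toFun u x = x := by
    intro u x hx
    apply Subtype.ext
    have hz : (x : 𝔼 (n + 1)) ∈ 𝕊 n := mem_sphere_zero_iff_norm.2 hx
    rw [hES', show T u 1 (x : 𝔼 (n + 1)) = ((𝒟 u 1 ⟨x, hz⟩ : 𝕊 n) : 𝔼 (n + 1)) from
      hTsph u 1 ⟨x, hz⟩, h𝒟fix u 1 (Or.inr le_rfl),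
      show Tinv 0 1 (((⟨x, hz⟩ : 𝕊 n) : 𝔼 (n + 1))) = ((𝒟inv 0 1 ⟨x, hz⟩ : 𝕊 n) : 𝔼 (n + 1)) from
      hTinvsph 0 1 ⟨x, hz⟩, h𝒟invfix 0 1 (Or.inr le_rfl)]
  -- Step 5: the untwisting of `T_{0,1} = (x ↦ A_{λ(‖x‖)} x)`
  obtain ⟨R, Rinv, hR, hRinv, hRR1, hRR2, hRn, hRinvn, hR0, hR1, hRsph⟩ := exists_untwistFamily hA hA01
  have hRD : ∀ u (x : 𝔻 (n + 1)), R u x ∈ 𝔻 (n + 1) := fun u x =>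
    mem_closedBall_zero_iff.2 ((hRn u x).le.trans (mem_closedBall_zero_iff.1 x.2))
  have hRinvD : ∀ u (x : 𝔻 (n + 1)), Rinv u x ∈ 𝔻 (n + 1) := fun u x =>
    mem_closedBall_zero_iff.2 ((hRinvn u x).le.trans (mem_closedBall_zero_iff.1 x.2))
  obtain ⟨ER, hER, hERinv⟩ := Diffeotopy.exists_ofAmbient (n := n)
    (k := fun q : ℝ × 𝔼 (n + 1) => R q.1 q.2) (k' := fun q : ℝ × 𝔼 (n + 1) => Rinv q.1 q.2)
    hR hRinv (fun u x => hRD u x) (fun u x => hRinvD u x) (fun u x => hRR1 u x) (fun u x => hRR2 u x)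
    (fun x => hR0 x)
  have hER' : ∀ (u : ℝ) (x : 𝔻 (n + 1)), ((ER.toFun u x : 𝔻 (n + 1)) : 𝔼 (n + 1)) = R u x :=
    fun u x => hER u x
  have hERfix : ∀ (u : ℝ) (x : 𝔻 (n + 1)), ‖(x : 𝔼 (n + 1))‖ = 1 → ER.toFun u x = x :=
    fun u x hx => Subtype.ext (by rw [hER']; exact hRsph u x hx)
  -- `T_{0,1} x = A_{λ(‖x‖)} x = R_1 x`
  have hT01 : ∀ x : 𝔼 (n + 1), T 0 1 x = R 1 x := by
    intro x
    rw [hTform, hR1, one_mul, h𝒟A]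
    by_cases hx : x = 0
    · subst hx; simp
    · rw [coe_sphereCongr, coe_radialProjection_of_ne_zero v hx, LinearIsometryEquiv.map_smul,
        smul_inv_smul₀ (norm_ne_zero_iff.2 hx)]
  -- Step 6: assemble `F = T_{1,1} ∘ K_1 = (R_1 ∘ (T_{0,1}⁻¹ ∘ T_{1,1})) ∘ K_1`
  have hrelK : ∃ D' : Diffeotopy (𝓡∂ (n + 1)) (𝔻 (n + 1)), D'.stage 1 = K.stage 1 ∧
      ∀ (t : ℝ) (x : 𝔻 (n + 1)), ‖(x : 𝔼 (n + 1))‖ = 1 → D'.toFun t x = x := ⟨K, rfl, hKfix⟩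
  have hrelES : ∃ D' : Diffeotopy (𝓡∂ (n + 1)) (𝔻 (n + 1)), D'.stage 1 = ES.stage 1 ∧
      ∀ (t : ℝ) (x : 𝔻 (n + 1)), ‖(x : 𝔼 (n + 1))‖ = 1 → D'.toFun t x = x := ⟨ES, rfl, hESfix⟩
  have hrelER : ∃ D' : Diffeotopy (𝓡∂ (n + 1)) (𝔻 (n + 1)), D'.stage 1 = ER.stage 1 ∧
      ∀ (t : ℝ) (x : 𝔻 (n + 1)), ‖(x : 𝔼 (n + 1))‖ = 1 → D'.toFun t x = x := ⟨ER, rfl, hERfix⟩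
  have hcomp := relSphere_trans hrelK (relSphere_trans hrelES hrelER)
  have heq : (K.stage 1).trans ((ES.stage 1).trans (ER.stage 1)) = F := by
    refine Diffeomorph.ext fun x => Subtype.ext ?_
    rw [Diffeomorph.coe_trans, Diffeomorph.coe_trans, comp_apply, comp_apply, Diffeotopy.coe_stage,
      Diffeotopy.coe_stage, Diffeotopy.coe_stage, hER', hES', hK, ← hT01, hTT2, ← hE',
      E.toFun_invFun, hD1 1 le_rfl]
  rw [heq] at hcomp
  exact hcomp

/-- **`π₀ Diff(Dⁿ⁺¹) = 0` (at the diffeomorphisms fixing the sphere) implies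
`π₀ Diff(Dⁿ⁺¹; Sⁿ) = 0`, modulo loops of `Diff(Sⁿ)`** — Cerf's "(4) ⟹ (2)" of Ch. I §2 for every
`n`, with the surjectivity of `π₁(SO(n+1)) → π₁(Diff Sⁿ)` (his 2°) as the explicit hypothesis
`hloops` in families form. [cite: CerfDiffeoSphere1968, Ch. I §2] -/
theorem discRelSphereTrivial_of_discTrivial_of_loops (v : 𝕊 n)
    (hloops : ∀ (B : Diffeotopy (𝓡 n) (𝕊 n)), (∀ t ≤ (0 : ℝ), B.toFun t = id) →
      (∀ t, (1 : ℝ) ≤ t → B.toFun t = id) →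
      ∃ (A : ℝ → (𝔼 (n + 1) ≃ₗᵢ[ℝ] 𝔼 (n + 1))) (𝒟 𝒟inv : ℝ → ℝ → (𝕊 n) → 𝕊 n),
        ContDiff ℝ ∞ (fun t => (A t : 𝔼 (n + 1) →L[ℝ] 𝔼 (n + 1))) ∧
        (∀ t, t ≤ 0 ∨ 1 ≤ t → A t = LinearIsometryEquiv.refl ℝ (𝔼 (n + 1))) ∧
        ContMDiff (𝓘(ℝ, ℝ).prod (𝓘(ℝ, ℝ).prod (𝓡 n))) (𝓡 n) ∞
          (fun p : ℝ × (ℝ × 𝕊 n) => 𝒟 p.1 p.2.1 p.2.2) ∧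
        ContMDiff (𝓘(ℝ, ℝ).prod (𝓘(ℝ, ℝ).prod (𝓡 n))) (𝓡 n) ∞
          (fun p : ℝ × (ℝ × 𝕊 n) => 𝒟inv p.1 p.2.1 p.2.2) ∧
        (∀ σ t x, 𝒟inv σ t (𝒟 σ t x) = x) ∧ (∀ σ t x, 𝒟 σ t (𝒟inv σ t x) = x) ∧
        (∀ t x, 𝒟 1 t x = B.toFun t x) ∧ (∀ t x, 𝒟 0 t x = sphereCongr (A t) x) ∧
        (∀ σ t, t ≤ 0 ∨ 1 ≤ t → ∀ x, 𝒟 σ t x = x))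
    (h4 : ∀ G : (𝔻 (n + 1)) ≃ₘ⟮𝓡∂ (n + 1), 𝓡∂ (n + 1)⟯ (𝔻 (n + 1)),
      (∀ x : 𝔻 (n + 1), ‖(x : 𝔼 (n + 1))‖ = 1 → G x = x) → Diffeomorph.IsDiffeotopicToId G) :
    ∀ F : (𝔻 (n + 1)) ≃ₘ⟮𝓡∂ (n + 1), 𝓡∂ (n + 1)⟯ (𝔻 (n + 1)),
      (∀ x : 𝔻 (n + 1), ‖(x : 𝔼 (n + 1))‖ = 1 → F x = x) →
      ∃ D : Diffeotopy (𝓡∂ (n + 1)) (𝔻 (n + 1)), D.stage 1 = F ∧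
        ∀ (t : ℝ) (x : 𝔻 (n + 1)), ‖(x : 𝔼 (n + 1))‖ = 1 → D.toFun t x = x :=
  fun F hF => relSphere_of_isDiffeotopicToId_of_loops v hloops F hF (h4 F hF)

end Literature.Topology.FourManifolds
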